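import Summits.ABC.IUTFork.Cor312UnitPositive
import Summits.ABC.IUTFork.Cor312PilotKummerCompatLevels
import HarnessLib

/-!
# [IUTchIII] Cor. 3.12 — the UNIT-INDETERMINACY test model, V: the LEVELS of print's Kummer/link-compatibility clause REVISITED UNDER UNITS

Record file (D-0012; proofs only — the two data are written inline; no `Prop` fact) of the abc-iut cell, by the REPAIR branch's on-call hand
abc-iut-w5-d147 (gen 3), downstream of abc-iut-w4-d101's unit model (parts I–III) and of part IV `Cor312UnitPositive` (`uWithQDatum`).
TAKES NO SIDE on [IUTchIII] Cor. 3.12 or on any author. REPAIR-SPEC RULINGS #3 (iii): «rows of the shape "modulo torsion vs modulo (Ind2)"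
wait for the unit model» — this file supplies the unit-axis versions of the level separations of p421800 / p422787 / p424841:

* §1 bookkeeping: the line-`0` splitting monoid IS `Ψ` as a set (`uLineZero_Psi`: `u₀⁰ = 1`); `orbitRegion` of the singleton `{θ}` is `B_{j²}`;
  `orbitRegion` is additive in the datum (`orbitRegion_union`).
* §2 THE UNIT-TWIST SINGLETON `D₁ = {Φ₀·θ}`, `Φ₀ = uFam u₀ ∈ (Ind2)` (`u₀ = 1 + p`, acting by `u₀^{j+1}` at label `j`): it generates `B_{j²}` (units fix
  balls), so pins / bridge hypotheses / `|log q| > 0` / the residual S / typed Cor. 3.12 all HOLD; the INCLUSION form HOLDS (`D₁ ⊆ Φ₀·Ψ`) —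
  whereas over the SIGN shells no non-sign unit multiple of `θ` lies in any indeterminacy-translate of `Ψ` (p422787) —; the EQUALITY form
  `PilotKummerCompat` still FAILS (torsion multiplicity: `Φ·Ψ` has two elements). So «INCL fails at unit multiples» was a SIGN-ONLY artefact,
  while C ⊊ INCL persists on the unit axis (`unitTwist_incl`, `unitTwist_not_pilotKummerCompat`).
* §3 THE TWO-CLASS DATUM `D₂ = {θ} ∪ D₁`: it generates `B_{j²}` (S, Statement hold) but lies in NO single indeterminacy-translate of `Ψ`
  (at label `1` the unit of `Φ` would be both `±1` and `±u₀²`), so INCL FAILS: INCL ⊋ S persists on the unit axis (`twoClass_not_incl`).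
* §4 census `unit_levels_separate` (∃-package over `uFull 2`).
HONEST SCOPE as parts I–IV: one place, `l⋆ = 2`, P♭-type data (grade SAT0); not a model of initial Θ-data. [claim: Mochizuki2012, status: disputed]
[cite: ScholzeStix2018, §2.2 pp. 9–10] Standard axioms; typed ≠ proved; instantiated ≠ endorsed.
-/

noncomputable section

namespace Summit.ABC.IUTFork.Cor312Vol.UnitWitness

open Set Thm311 Cor312 Cor312.Checks Cor312.IdentifiedNonVacuity NaiveWitness PinnedWitness Literature.IUT.LogThetaLattice

variable (p : ℕ) [hp : Fact p.Prime]

/-! ## 1. Bookkeeping -/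

/-- The column unit of line `0` is `u₀⁰ = 1`: its (Ind2)-family acts as the identity on every star packet. [folklore] -/
theorem starAut_lineFam_zero_apply (v : toyIndex.V) (ψ : (unitShells p).StarPacket v) :
    (unitShells p).starAut (lineFam p 0) v ψ = ψ := by
  funext j
  apply (line j.1 (toyIndex.over v)).injective
  show line j.1 (toyIndex.over v) (uFam p (u₀ p ^ (0 : ℤ)) (u₀_zpow_isPUnit p 0).1 j.1 (toyIndex.over v) (ψ j)) = _
  rw [line_uFam, zpow_zero, one_pow, one_mul]

/-- **The line-`0` splitting monoid IS `Ψ = {(±q^{j²})_j}` as a set.** [folklore] -/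
theorem uLineZero_Psi (v : toyIndex.V) (hv : v ∈ toyIndex.Vbad) : (uLine p 0).Ψ v hv = Psi p v := by
  rw [uLine_Psi]
  ext ψ
  constructor
  · rintro ⟨ψ', hψ', rfl⟩
    rwa [starAut_lineFam_zero_apply]
  · intro h
    exact ⟨ψ, h, starAut_lineFam_zero_apply p v ψ⟩

/-- Every column-`0` Kummer image of the Θ-pilot splitting monoid is `Ψ` as a set. [folklore] -/
theorem uColumnZero_frobΨ (m : ℤ) (v : toyIndex.V) (hv : v ∈ toyIndex.Vbad) : (uColumn p 0).frobΨ m v hv = Psi p v := by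
  rw [uColumn_frobΨ, uLineZero_Psi]

/-- The region of the singleton `{θ}` is `B_{j²}`. [folklore] -/
theorem orbitRegion_thetaSingletonU (j : toyIndex.Label) (vQ : toyIndex.VQ) :
    orbitRegion p (fun v _ => ({thetaValues p v} : Set ((unitShells p).StarPacket v))) j vQ = uBall p j vQ (jsq j) := by
  by_cases hj : j = 0
  · subst hj
    rw [orbitRegion_zero]
    rfl
  · have hθ : line j vQ (thetaValues p vQ ⟨j, hj⟩) = (p : ℚ) ^ ((j : ℕ) ^ 2) := by
      show line j vQ ((line j vQ).symm ((p : ℚ) ^ ((j : ℕ) ^ 2))) = _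
      rw [LinearEquiv.apply_symm_apply]
    exact orbitRegion_eq_pBall_of p hj vQ _ ((j : ℕ) ^ 2) (fun ψ hψ => Or.inl (by rw [Set.mem_singleton_iff.1 hψ, hθ]))
      (thetaValues p vQ) (Set.mem_singleton _) hθ

omit hp in
/-- `orbitRegion` is ADDITIVE in the datum. [folklore] -/
theorem orbitRegion_union (A B : ∀ v : toyIndex.V, v ∈ toyIndex.Vbad → Set ((unitShells p).StarPacket v))
    (j : toyIndex.Label) (vQ : toyIndex.VQ) :
    orbitRegion p (fun v hv => A v hv ∪ B v hv) j vQ = orbitRegion p A j vQ ∪ orbitRegion p B j vQ := by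
  unfold orbitRegion
  split_ifs with hj
  · exact (Set.union_self _).symm
  · ext x
    simp only [Set.mem_setOf_eq, Set.mem_union]
    constructor
    · rintro ⟨ψ, hψ | hψ, u, hu, hx⟩
      · exact Or.inl ⟨ψ, hψ, u, hu, hx⟩
      · exact Or.inr ⟨ψ, hψ, u, hu, hx⟩
    · rintro (⟨ψ, hψ, u, hu, hx⟩ | ⟨ψ, hψ, u, hu, hx⟩)
      · exact ⟨ψ, Or.inl hψ, u, hu, hx⟩
      · exact ⟨ψ, Or.inr hψ, u, hu, hx⟩

/-! ## 2. The unit-twist singleton `D₁ = {Φ₀·θ}`: INCL holds, the equality form fails -/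

/-- The region of the unit-twist singleton is `B_{j²}` (equivariance + units fix balls). [folklore] -/
theorem orbitRegion_unitTwist (j : toyIndex.Label) (vQ : toyIndex.VQ) :
    orbitRegion p (fun v _ => (unitShells p).starAut (uFam p (u₀ p) (u₀_isPUnit p).1) v '' {thetaValues p v}) j vQ =
      uBall p j vQ (jsq j) :=
  (orbitRegion_equivariantU p (uFam_mem_closure p (u₀_isPUnit p)) (fun v _ => {thetaValues p v}) j vQ).trans
    (by rw [orbitRegion_thetaSingletonU, image_uBall_of_actsByUnits (uFam_actsByUnits p (u₀_isPUnit p))])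

/-- The side condition of `uWithQDatum` for `D₁`. [folklore] -/
theorem unitTwist_hul (j : toyIndex.Label) (vQ : toyIndex.VQ) :
    ∃ k : ℤ, uBall p j vQ k =
      orbitRegion p (fun v _ => (unitShells p).starAut (uFam p (u₀ p) (u₀_isPUnit p).1) v '' {thetaValues p v}) j vQ :=
  ⟨jsq j, (orbitRegion_unitTwist p j vQ).symm⟩

/-- **INCL HOLDS at the unit-twist singleton**: `D₁ = Φ₀·{θ} ⊆ Φ₀·Ψ = Φ₀·Ψ^{Frob}_{(0,0)}` with `Φ₀ = uFam u₀ ∈ (Ind2)` — a NON-SIGN unit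
translate of a theta tuple IS inside an indeterminacy-translate of the splitting monoid on the unit axis (contrast p422787 over the
sign shells). [claim: Mochizuki2012, status: disputed] -/
theorem unitTwist_incl :
    ∃ Φ ∈ Subgroup.closure ((unitShells p).Ind1Family ∪ (unitShells p).Ind2Family), ∃ m : ℤ,
      ∀ (v : toyIndex.V) (hv : v ∈ toyIndex.Vbad),
        (unitShells p).starAut (uFam p (u₀ p) (u₀_isPUnit p).1) v '' {thetaValues p v} ⊆
          (unitShells p).starAut Φ v '' (uColumn p 0).frobΨ m v hv := by
  refine ⟨uFam p (u₀ p) (u₀_isPUnit p).1, uFam_mem_closure p (u₀_isPUnit p), 0, fun v hv => ?_⟩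
  rw [uColumnZero_frobΨ]
  exact Set.image_mono (Set.singleton_subset_iff.2 (thetaValues_mem_Psi p v))

/-- **The EQUALITY form `PilotKummerCompat` FAILS at the unit-twist singleton**: every `Φ·Ψ^{Frob}_{(0,m)} = Φ·Ψ` has TWO distinct elements
`Φ(±θ)`, a singleton has one (torsion multiplicity, as in p421800). [folklore] -/
theorem unitTwist_not_pilotKummerCompat :
    ¬ PilotKummerCompat (uFull p).toLatticeSituation
        (uWithQDatum p (fun v _ => (unitShells p).starAut (uFam p (u₀ p) (u₀_isPUnit p).1) v '' {thetaValues p v})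
          (unitTwist_hul p))
        (fun v _ => (unitShells p).starAut (uFam p (u₀ p) (u₀_isPUnit p).1) v '' {thetaValues p v}) := by
  rintro ⟨Φ, -, m, hm⟩
  have hfrob : ((uFull p).toLatticeSituation.col
      (uWithQDatum p (fun v _ => (unitShells p).starAut (uFam p (u₀ p) (u₀_isPUnit p).1) v '' {thetaValues p v})
        (unitTwist_hul p)).n).frobΨ m () trivial = Psi p () := uColumnZero_frobΨ p m () trivial
  have hθ : (unitShells p).starAut (uFam p (u₀ p) (u₀_isPUnit p).1) () '' {thetaValues p ()} =
      (unitShells p).starAut Φ () '' Psi p () := by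
    have h := hm () trivial
    rw [hfrob] at h
    exact h
  have hmem : ∀ f ∈ Psi p (), (unitShells p).starAut Φ () f =
      (unitShells p).starAut (uFam p (u₀ p) (u₀_isPUnit p).1) () (thetaValues p ()) := fun f hf => by
    have h1 : (unitShells p).starAut Φ () f ∈ (unitShells p).starAut (uFam p (u₀ p) (u₀_isPUnit p).1) () '' {thetaValues p ()} := by
      rw [hθ]; exact Set.mem_image_of_mem _ hf
    obtain ⟨y, hy, hxy⟩ := h1
    rw [Set.mem_singleton_iff.1 hy] at hxy
    exact hxy.symm
  have h1 := hmem _ (thetaValues_mem_Psi p ())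
  have h2 := hmem _ (neg_thetaValues_mem_Psi p ())
  exact thetaValues_ne_neg p () (((unitShells p).starAut Φ ()).injective (h1.trans h2.symm))

/-- At the unit-twist singleton: three pins ✓, bridge hypotheses ✓, `|log(q)| > 0` ✓, residual S ✓, typed Cor. 3.12 ✓. [claim: Mochizuki2012, status: disputed] -/
theorem unitTwist_levels :
    PinnedRegions3 (uFull p).toLatticeSituation
        (uWithQDatum p (fun v _ => (unitShells p).starAut (uFam p (u₀ p) (u₀_isPUnit p).1) v '' {thetaValues p v})
          (unitTwist_hul p)) (orbitRegion p)
        (fun v _ => (unitShells p).starAut (uFam p (u₀ p) (u₀_isPUnit p).1) v '' {thetaValues p v}) ∧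
      BridgeHyps (uWithQDatum p (fun v _ => (unitShells p).starAut (uFam p (u₀ p) (u₀_isPUnit p).1) v '' {thetaValues p v})
        (unitTwist_hul p)) ∧
      (uWithQDatum p (fun v _ => (unitShells p).starAut (uFam p (u₀ p) (u₀_isPUnit p).1) v '' {thetaValues p v})
        (unitTwist_hul p)).AbsLogQPos ∧
      PilotKummerIndRelated (uFull p).toLatticeSituation
        (uWithQDatum p (fun v _ => (unitShells p).starAut (uFam p (u₀ p) (u₀_isPUnit p).1) v '' {thetaValues p v})
          (unitTwist_hul p)) (orbitRegion p)
        (fun v _ => (unitShells p).starAut (uFam p (u₀ p) (u₀_isPUnit p).1) v '' {thetaValues p v}) ∧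
      (uWithQDatum p (fun v _ => (unitShells p).starAut (uFam p (u₀ p) (u₀_isPUnit p).1) v '' {thetaValues p v})
        (unitTwist_hul p)).Statement :=
  ⟨uWithQDatum_pinnedRegions3 p _ _, uWithQDatum_bridgeHyps p _ _,
    (uWithQDatum_absLogQPos_statement_of_generates p _ _ (orbitRegion_unitTwist p)).1,
    (uWithQDatum_pilotKummerIndRelated_iff p _ _).2 (orbitRegion_unitTwist p),
    (uWithQDatum_absLogQPos_statement_of_generates p _ _ (orbitRegion_unitTwist p)).2.1⟩

/-! ## 3. The two-class datum `D₂ = {θ} ∪ {Φ₀·θ}`: S holds, INCL fails -/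

/-- The region of `D₂` is `B_{j²}`. [folklore] -/
theorem orbitRegion_twoClass (j : toyIndex.Label) (vQ : toyIndex.VQ) :
    orbitRegion p (fun v _ => ({thetaValues p v} : Set ((unitShells p).StarPacket v)) ∪
        (unitShells p).starAut (uFam p (u₀ p) (u₀_isPUnit p).1) v '' {thetaValues p v}) j vQ = uBall p j vQ (jsq j) := by
  rw [orbitRegion_union, orbitRegion_thetaSingletonU, orbitRegion_unitTwist]
  exact Set.union_self _

/-- The side condition for `D₂`. [folklore] -/
theorem twoClass_hul (j : toyIndex.Label) (vQ : toyIndex.VQ) :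
    ∃ k : ℤ, uBall p j vQ k =
      orbitRegion p (fun v _ => ({thetaValues p v} : Set ((unitShells p).StarPacket v)) ∪
        (unitShells p).starAut (uFam p (u₀ p) (u₀_isPUnit p).1) v '' {thetaValues p v}) j vQ :=
  ⟨jsq j, (orbitRegion_twoClass p j vQ).symm⟩

/-- `u₀ⁿ ∉ {1, −1}` for `n ≠ 0` (`u₀ = 1 + p > 1`). [folklore] -/
theorem u₀_pow_ne (n : ℕ) (hn : n ≠ 0) (ε : ℚ) (hε : ε = 1 ∨ ε = -1) : (u₀ p) ^ n ≠ ε := by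
  have h2 : (1 : ℚ) < u₀ p ^ n := one_lt_pow₀ (one_lt_u₀ p) hn
  rcases hε with rfl | rfl <;> intro h <;> linarith

/-- **INCL FAILS at the two-class datum**: no single indeterminacy-translate `Φ·Ψ` contains both `θ` and `Φ₀·θ` — at label `1`, `Φ` multiplies the
line by a unit `c` and `Ψ`'s components are `±q`, so `θ ∈ Φ·Ψ` forces `c = ±1` while `Φ₀·θ ∈ Φ·Ψ` forces `c = ±u₀²`. [folklore] -/
theorem twoClass_not_incl :
    ¬ ∃ Φ ∈ Subgroup.closure ((unitShells p).Ind1Family ∪ (unitShells p).Ind2Family), ∃ m : ℤ,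
        ∀ (v : toyIndex.V) (hv : v ∈ toyIndex.Vbad),
          (({thetaValues p v} : Set ((unitShells p).StarPacket v)) ∪
              (unitShells p).starAut (uFam p (u₀ p) (u₀_isPUnit p).1) v '' {thetaValues p v}) ⊆
            (unitShells p).starAut Φ v '' (uColumn p 0).frobΨ m v hv := by
  rintro ⟨Φ, hΦ, m, hsub⟩
  have h := hsub () trivial
  rw [uColumnZero_frobΨ] at h
  obtain ⟨c, hc, hline⟩ := (actsByUnits_of_mem_closure hΦ).unit 1 ()
  have hp0 : (p : ℚ) ≠ 0 := Nat.cast_ne_zero.mpr hp.out.ne_zero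
  have hθ1 : line 1 () (thetaValues p () ⟨1, by decide⟩) = p := by
    show line 1 () ((line 1 ()).symm ((p : ℚ) ^ (((1 : toyIndex.Label) : ℕ) ^ 2))) = _
    rw [LinearEquiv.apply_symm_apply, show (((1 : toyIndex.Label) : ℕ) ^ 2) = 1 from rfl, pow_one]
  -- a member `Φ ψ` of `Φ·Ψ` has label-1 line `c · (±p)`
  have key : ∀ x ∈ (unitShells p).starAut Φ () '' Psi p (),
      line 1 () (x ⟨1, by decide⟩) = c * p ∨ line 1 () (x ⟨1, by decide⟩) = -c * p := by
    rintro _ ⟨ψ, hψ, rfl⟩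
    have hcomp : (unitShells p).starAut Φ () ψ ⟨1, by decide⟩ = Φ 1 () (ψ ⟨1, by decide⟩) := rfl
    rw [hcomp, hline]
    rcases hψ ⟨1, by decide⟩ with h1 | h1
    · left
      have h1' : line 1 () (ψ ⟨1, by decide⟩) = p := by
        have h2 := h1
        rw [show (((1 : toyIndex.Label) : ℕ) ^ 2) = 1 from rfl, pow_one] at h2
        exact h2
      rw [h1']
    · right
      have h1' : line 1 () (ψ ⟨1, by decide⟩) = -p := by
        have h2 := h1
        rw [show (((1 : toyIndex.Label) : ℕ) ^ 2) = 1 from rfl, pow_one] at h2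
        exact h2
      rw [h1']; ring
  -- θ ∈ Φ·Ψ ⇒ c = ±1
  have hθmem := key _ (h (Or.inl (Set.mem_singleton _)))
  rw [hθ1] at hθmem
  have hc1 : c = 1 ∨ c = -1 := by
    rcases hθmem with h1 | h1
    · left
      have h2 : (1 : ℚ) * p = c * p := by rw [one_mul]; exact h1
      exact (mul_right_cancel₀ hp0 h2).symm
    · right
      have h2 : (1 : ℚ) * p = -c * p := by rw [one_mul]; exact h1
      have h3 := mul_right_cancel₀ hp0 h2
      linarith
  -- Φ₀θ ∈ Φ·Ψ ⇒ u₀² = ±c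
  have hΦ₀mem := key _ (h (Or.inr (Set.mem_image_of_mem _ (Set.mem_singleton _))))
  have hcomp₀ : (unitShells p).starAut (uFam p (u₀ p) (u₀_isPUnit p).1) () (thetaValues p ()) ⟨1, by decide⟩ =
      uFam p (u₀ p) (u₀_isPUnit p).1 1 () (thetaValues p () ⟨1, by decide⟩) := rfl
  rw [hcomp₀, line_uFam, hθ1] at hΦ₀mem
  rcases hΦ₀mem with h1 | h1
  · exact u₀_pow_ne p _ (Nat.succ_ne_zero _) c hc1 (mul_right_cancel₀ hp0 h1)
  · exact u₀_pow_ne p _ (Nat.succ_ne_zero _) (-c) (by rcases hc1 with rfl | rfl <;> norm_num) (mul_right_cancel₀ hp0 h1)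

/-- At the two-class datum: three pins ✓, bridge ✓, `|log(q)| > 0` ✓, residual S ✓, typed Cor. 3.12 ✓ — and INCL ✗. [claim: Mochizuki2012, status: disputed] -/
theorem twoClass_levels :
    PinnedRegions3 (uFull p).toLatticeSituation
        (uWithQDatum p (fun v _ => ({thetaValues p v} : Set ((unitShells p).StarPacket v)) ∪
          (unitShells p).starAut (uFam p (u₀ p) (u₀_isPUnit p).1) v '' {thetaValues p v}) (twoClass_hul p)) (orbitRegion p)
        (fun v _ => ({thetaValues p v} : Set ((unitShells p).StarPacket v)) ∪
          (unitShells p).starAut (uFam p (u₀ p) (u₀_isPUnit p).1) v '' {thetaValues p v}) ∧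
      BridgeHyps (uWithQDatum p (fun v _ => ({thetaValues p v} : Set ((unitShells p).StarPacket v)) ∪
          (unitShells p).starAut (uFam p (u₀ p) (u₀_isPUnit p).1) v '' {thetaValues p v}) (twoClass_hul p)) ∧
      (uWithQDatum p (fun v _ => ({thetaValues p v} : Set ((unitShells p).StarPacket v)) ∪
          (unitShells p).starAut (uFam p (u₀ p) (u₀_isPUnit p).1) v '' {thetaValues p v}) (twoClass_hul p)).AbsLogQPos ∧
      PilotKummerIndRelated (uFull p).toLatticeSituation
        (uWithQDatum p (fun v _ => ({thetaValues p v} : Set ((unitShells p).StarPacket v)) ∪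
          (unitShells p).starAut (uFam p (u₀ p) (u₀_isPUnit p).1) v '' {thetaValues p v}) (twoClass_hul p)) (orbitRegion p)
        (fun v _ => ({thetaValues p v} : Set ((unitShells p).StarPacket v)) ∪
          (unitShells p).starAut (uFam p (u₀ p) (u₀_isPUnit p).1) v '' {thetaValues p v}) ∧
      (uWithQDatum p (fun v _ => ({thetaValues p v} : Set ((unitShells p).StarPacket v)) ∪
          (unitShells p).starAut (uFam p (u₀ p) (u₀_isPUnit p).1) v '' {thetaValues p v}) (twoClass_hul p)).Statement :=
  ⟨uWithQDatum_pinnedRegions3 p _ _, uWithQDatum_bridgeHyps p _ _,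
    (uWithQDatum_absLogQPos_statement_of_generates p _ _ (orbitRegion_twoClass p)).1,
    (uWithQDatum_pilotKummerIndRelated_iff p _ _).2 (orbitRegion_twoClass p),
    (uWithQDatum_absLogQPos_statement_of_generates p _ _ (orbitRegion_twoClass p)).2.1⟩

/-! ## 4. Census on the unit axis -/

omit hp in
/-- **THE LEVELS ON THE UNIT AXIS — census** over abc-iut-w4-d101's unit model at `p = 2` (typed Thm. 3.11 with distinct lines and an infinite
non-sign indeterminacy group): two three-pinned, bridge-complete settings with `|log(q)| > 0`, the residual S and typed Cor. 3.12 TRUE —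
the UNIT-TWIST SINGLETON: INCL ✓, equality form ✗; the TWO-CLASS datum: INCL ✗. So «EQUALITY ⟹ INCL ⟹ REGION ⟺ S» keeps BOTH first arrows
strict under units, and a non-sign unit translate now sits INSIDE an indeterminacy-translate. [claim: Mochizuki2012, status: disputed] -/
theorem unit_levels_separate :
    ∃ (T : ThetaIndex) (F : FullSituation T)
      (ρ : (∀ v : T.V, v ∈ T.Vbad → Set (F.L.StarPacket v)) → ∀ (j : T.Label) (vQ : T.VQ), Set (F.L.Packet j vQ)),
      F.Statement ∧ (∀ n n' : ℤ, F.D n = F.D n' → n = n') ∧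
      (∃ (qK : ∀ v : T.V, v ∈ T.Vbad → Set (F.L.StarPacket v)) (P : Cor312.Setting F.toLatticeSituation.toSituation),
        BridgeHyps P ∧ P.AbsLogQPos ∧ PinnedRegions3 F.toLatticeSituation P ρ qK ∧
          PilotKummerIndRelated F.toLatticeSituation P ρ qK ∧ P.Statement ∧
          (∃ Φ ∈ Subgroup.closure (F.L.Ind1Family ∪ F.L.Ind2Family), ∃ m : ℤ,
            ∀ (v : T.V) (hv : v ∈ T.Vbad), qK v hv ⊆ F.L.starAut Φ v '' (F.toLatticeSituation.col P.n).frobΨ m v hv) ∧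
          ¬ PilotKummerCompat F.toLatticeSituation P qK) ∧
      (∃ (qK : ∀ v : T.V, v ∈ T.Vbad → Set (F.L.StarPacket v)) (P : Cor312.Setting F.toLatticeSituation.toSituation),
        BridgeHyps P ∧ P.AbsLogQPos ∧ PinnedRegions3 F.toLatticeSituation P ρ qK ∧
          PilotKummerIndRelated F.toLatticeSituation P ρ qK ∧ P.Statement ∧
          ¬ ∃ Φ ∈ Subgroup.closure (F.L.Ind1Family ∪ F.L.Ind2Family), ∃ m : ℤ,
            ∀ (v : T.V) (hv : v ∈ T.Vbad), qK v hv ⊆ F.L.starAut Φ v '' (F.toLatticeSituation.col P.n).frobΨ m v hv) := by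
  haveI : Fact (Nat.Prime 2) := ⟨Nat.prime_two⟩
  obtain ⟨a1, a2, a3, a4, a5⟩ := unitTwist_levels 2
  obtain ⟨b1, b2, b3, b4, b5⟩ := twoClass_levels 2
  exact ⟨toyIndex, uFull 2, orbitRegion 2, uFull_statement 2, uFull_lines_distinct 2,
    ⟨_, _, a2, a3, a1, a4, a5, unitTwist_incl 2, unitTwist_not_pilotKummerCompat 2⟩,
    ⟨_, _, b2, b3, b1, b4, b5, twoClass_not_incl 2⟩⟩

end Summit.ABC.IUTFork.Cor312Vol.UnitWitness

end
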